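import Summits.QuantumFields.YangMills.Theorems.ColdStartUniversalityLatticeLangevinFunctionalInequalitiesOfCarre
import HarnessLib

/-!
# The ENERGY FORM of the volume-uniform log-Sobolev inequality for the `SU(2)` Wilson–Gibbs measure on `(ℤ/L)³` at `|β'| < 1/12`,
# `Ent_(μ_β')(F²) ≤ (1/(1 − 12|β'|))·∫Γ^A(f) dμ_(β')`, and the chain rule `Γ^A(e^{g/2}) = e^g·Γ^A(g)/4`

Seat `ym-line-csu-p1` (g42), route `ColdStartUniversality` of `Summits/QuantumFields/YangMills`, helper file G70a (`--supports stmt-QuantumFields-24809`).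
The Bakry–Émery log-Sobolev inequality of g26 (`wilson_generatorLogSobolev_uniform`, generator form `((1−12|β'|)/2)·Ent(F²) ≤ −∫F𝓛f`) combined with
the energy identity `2∫F𝓛f = −∫Γ^A f` of g38 (`two_mul_integral_mul_generator_eq_neg_carre`, on a compactly supported copy of `f` that agrees with `f`
near the range of the coordinates) gives the energy form; §2 is the elementary chain rule used to pass from `F²` to `e^F` (input of the Otto–Villani /
Herbst arguments of G70b).

* ★★ `wilson_entropy_le_integral_carre_uniform` — `∫F² log F² dμ_(β') − (∫F² dμ_(β')) log ∫F² dμ_(β') ≤ (1/(1−12|β'|))·∫Γ^A(f) dμ_(β')`, `F = f∘coords`,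
  `f ∈ C³`, every `L`;
* ★★ `carre_exp_half` — `Γ^A(y ↦ e^{g(y)/2})(V) = (e^{g(coords V)}/4)·Γ^A(g)(V)` for differentiable `g`.

THEOREMS ONLY, no definition, no sorry.  HONEST FRAMING: fixed cut-off, finite volume, `|β'| < 1/12`; "uniform" = the constant does not depend on `L`;
nothing `K`-uniform along the route's scaling; `UniformColdStartMixing` (24809, ASIDE) is not restated; no crux, rung or summit statement is proved;
the Yang–Mills mass gap is NOT proved.
-/

set_option autoImplicit false

noncomputable section

namespace Summit.QuantumFields.YangMills.Theorems.ColdStartUniversality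

open MeasureTheory ProbabilityTheory Matrix Complex Finset Filter Topology Set Metric InformationTheory
open scoped ComplexConjugate BigOperators NNReal ENNReal
open Literature.Probability.Process Literature.MathematicalPhysics.QuantumFieldTheory
open Literature.MathematicalPhysics.QuantumLattice (fundamentalRep fundamentalLatticeRep continuous_fundamentalRep fundamentalRep_apply fundamentalLatticeRep_N)

variable {L : ℕ} [NeZero L]

/-! ## §1. The energy form of the volume-uniform log-Sobolev inequality -/

/-- ★★ **Energy-form log-Sobolev inequality, uniformly in the volume.**  For `|β'| < 1/12`, every `L` and every `C³` function `f` of the link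
coordinates, `F = f∘coords`:  `∫F² log F² dμ_(β') − (∫F² dμ_(β')) log ∫F² dμ_(β') ≤ (1/(1 − 12|β'|))·∫ Γ^A(f) dμ_(β')`
(g26's generator form + g38's energy identity on a compactly supported copy of `f`). [cite: ShenZhuZhu2022, §4 Theorem 4.2 and Corollary 4.4 (4.12)] -/
theorem wilson_entropy_le_integral_carre_uniform (L : ℕ) [NeZero L] (β' : ℝ) (hβ : |β'| < 1 / 12)
    (f : (Edge 3 L × Fin 2 × Fin 2 × Bool → ℝ) → ℝ) (hf : ContDiff ℝ 3 f) :
    let coords : GaugeConfig 3 L (Matrix.specialUnitaryGroup (Fin 2) ℂ) → (Edge 3 L × Fin 2 × Fin 2 × Bool → ℝ) :=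
      fun V q => (fun z : ℂ => if q.2.2.2 then z.im else z.re)
        ((fundamentalRep (Fin 2) (V q.1) : Matrix (Fin 2) (Fin 2) ℂ) q.2.1 q.2.2.1)
    let A : GaugeConfig 3 L (Matrix.specialUnitaryGroup (Fin 2) ℂ) → (Edge 3 L × Fin 2 × Fin 2 × Bool) →
        (Edge 3 L × Fin 2 × Fin 2 × Bool) → ℝ := fun V i j =>
      ∑ n : Edge 3 L × NoiseIdx 2,
        (if n.1 = i.1 then (fun z : ℂ => if i.2.2.2 then z.im else z.re)
          ((latticeLangevinDynamics (fundamentalLatticeRep 2) β').noise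
            (matrixConfig (fundamentalRep (Fin 2)) V) i.1 n.2 i.2.1 i.2.2.1) else 0) *
        (if n.1 = j.1 then (fun z : ℂ => if j.2.2.2 then z.im else z.re)
          ((latticeLangevinDynamics (fundamentalLatticeRep 2) β').noise
            (matrixConfig (fundamentalRep (Fin 2)) V) j.1 n.2 j.2.1 j.2.2.1) else 0)
    (∫ V, f (coords V) ^ 2 * Real.log (f (coords V) ^ 2) ∂(wilsonMeasure (d := 3) (L := L) (fundamentalRep (Fin 2)) β')) -
        (∫ V, f (coords V) ^ 2 ∂(wilsonMeasure (d := 3) (L := L) (fundamentalRep (Fin 2)) β')) *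
          Real.log (∫ V, f (coords V) ^ 2 ∂(wilsonMeasure (d := 3) (L := L) (fundamentalRep (Fin 2)) β')) ≤
      1 / (1 - 12 * |β'|) * ∫ V, (∑ i : Edge 3 L × Fin 2 × Fin 2 × Bool, ∑ j : Edge 3 L × Fin 2 × Fin 2 × Bool,
        fderiv ℝ f (coords V) (Pi.single i 1) * fderiv ℝ f (coords V) (Pi.single j 1) * A V i j) ∂(wilsonMeasure (d := 3) (L := L) (fundamentalRep (Fin 2)) β') := by
  intro coords A
  classical
  haveI := secondCountableTopology_su2
  haveI := borelSpace_config L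
  haveI : IsProbabilityMeasure (wilsonMeasure (d := 3) (L := L) (fundamentalRep (Fin 2)) β') :=
    isProbabilityMeasure_wilsonMeasure (d := 3) (L := L) (fundamentalRep (Fin 2)) (continuous_fundamentalRep (Fin 2)) β'
  have hc : 0 < 1 - 12 * |β'| := by linarith
  have hco : Continuous coords := continuous_coords (L := L)
  let gen : ((Edge 3 L × Fin 2 × Fin 2 × Bool → ℝ) → ℝ) → GaugeConfig 3 L (Matrix.specialUnitaryGroup (Fin 2) ℂ) → ℝ :=
      fun h V =>
      (∑ i : Edge 3 L × Fin 2 × Fin 2 × Bool, fderiv ℝ h (coords V) (Pi.single i 1) *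
          (fun z : ℂ => if i.2.2.2 then z.im else z.re)
            ((latticeLangevinDynamics (fundamentalLatticeRep 2) β').drift
              (matrixConfig (fundamentalRep (Fin 2)) V) i.1 i.2.1 i.2.2.1) +
      1 / 2 * ∑ i : Edge 3 L × Fin 2 × Fin 2 × Bool, ∑ j : Edge 3 L × Fin 2 × Fin 2 × Bool,
        fderiv ℝ (fun z => fderiv ℝ h z (Pi.single i 1)) (coords V) (Pi.single j 1) *
          ∑ n : Edge 3 L × NoiseIdx 2,
            (if n.1 = i.1 then (fun z : ℂ => if i.2.2.2 then z.im else z.re)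
              ((latticeLangevinDynamics (fundamentalLatticeRep 2) β').noise
                (matrixConfig (fundamentalRep (Fin 2)) V) i.1 n.2 i.2.1 i.2.2.1) else 0) *
            (if n.1 = j.1 then (fun z : ℂ => if j.2.2.2 then z.im else z.re)
              ((latticeLangevinDynamics (fundamentalLatticeRep 2) β').noise
                (matrixConfig (fundamentalRep (Fin 2)) V) j.1 n.2 j.2.1 j.2.2.1) else 0))
  -- log-Sobolev in generator form
  have hP : (1 - 12 * |β'|) / 2 * ((∫ V, f (coords V) ^ 2 * Real.log (f (coords V) ^ 2) ∂(wilsonMeasure (d := 3) (L := L) (fundamentalRep (Fin 2)) β')) -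
      (∫ V, f (coords V) ^ 2 ∂(wilsonMeasure (d := 3) (L := L) (fundamentalRep (Fin 2)) β')) * Real.log (∫ V, f (coords V) ^ 2 ∂(wilsonMeasure (d := 3) (L := L) (fundamentalRep (Fin 2)) β'))) ≤
      -∫ V, f (coords V) * gen f V ∂(wilsonMeasure (d := 3) (L := L) (fundamentalRep (Fin 2)) β') :=
    wilson_generatorLogSobolev_uniform L β' hβ f hf
  -- a compactly supported copy of `f`
  let χ : ContDiffBump (0 : (Edge 3 L × Fin 2 × Fin 2 × Bool → ℝ)) := ⟨2, 3, by norm_num, by norm_num⟩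
  set g₁ : (Edge 3 L × Fin 2 × Fin 2 × Bool → ℝ) → ℝ := fun y => (χ : (Edge 3 L × Fin 2 × Fin 2 × Bool → ℝ) → ℝ) y * f y with hg₁def
  have hg₁ : ContDiff ℝ 3 g₁ := χ.contDiff.mul hf
  have hg₁c : HasCompactSupport g₁ := χ.hasCompactSupport.mul_right
  have hball : ∀ V : (GaugeConfig 3 L (Matrix.specialUnitaryGroup (Fin 2) ℂ)), coords V ∈ ball (0 : (Edge 3 L × Fin 2 × Fin 2 × Bool → ℝ)) 2 := by
    intro V
    rw [mem_ball, dist_zero_right]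
    exact (norm_coords_le_one V).trans_lt (by norm_num)
  have hg₁ev : ∀ V : (GaugeConfig 3 L (Matrix.specialUnitaryGroup (Fin 2) ℂ)), g₁ =ᶠ[𝓝 (coords V)] f := by
    intro V
    filter_upwards [isOpen_ball.mem_nhds (hball V)] with z hz
    have h1 : (χ : (Edge 3 L × Fin 2 × Fin 2 × Bool → ℝ) → ℝ) z = 1 := χ.one_of_mem_closedBall (ball_subset_closedBall hz)
    simp only [hg₁def, h1, one_mul]
  have hg₁val : ∀ V : (GaugeConfig 3 L (Matrix.specialUnitaryGroup (Fin 2) ℂ)), g₁ (coords V) = f (coords V) := fun V => (hg₁ev V).self_of_nhds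
  have hg₁gen : ∀ V : (GaugeConfig 3 L (Matrix.specialUnitaryGroup (Fin 2) ℂ)), gen g₁ V = gen f V := fun V => generator_congr_of_eventuallyEq L β' V (hg₁ev V)
  have hg₁fd : ∀ V : (GaugeConfig 3 L (Matrix.specialUnitaryGroup (Fin 2) ℂ)), fderiv ℝ g₁ (coords V) = fderiv ℝ f (coords V) := fun V => by
    rw [(hg₁ev V).fderiv_eq]
  have hEn : 2 * ∫ V, g₁ (coords V) * gen g₁ V ∂(wilsonMeasure (d := 3) (L := L) (fundamentalRep (Fin 2)) β') =
      -∫ V, (∑ i : Edge 3 L × Fin 2 × Fin 2 × Bool, ∑ j : Edge 3 L × Fin 2 × Fin 2 × Bool, fderiv ℝ g₁ (coords V) (Pi.single i 1) * fderiv ℝ g₁ (coords V) (Pi.single j 1) * A V i j) ∂(wilsonMeasure (d := 3) (L := L) (fundamentalRep (Fin 2)) β') :=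
    two_mul_integral_mul_generator_eq_neg_carre L β' hg₁ hg₁c
  have e1 : ∫ V, f (coords V) * gen f V ∂(wilsonMeasure (d := 3) (L := L) (fundamentalRep (Fin 2)) β') = ∫ V, g₁ (coords V) * gen g₁ V ∂(wilsonMeasure (d := 3) (L := L) (fundamentalRep (Fin 2)) β') :=
    integral_congr_ae (ae_of_all _ fun V => by beta_reduce; rw [hg₁val V, hg₁gen V])
  have e3 : ∫ V, (∑ i : Edge 3 L × Fin 2 × Fin 2 × Bool, ∑ j : Edge 3 L × Fin 2 × Fin 2 × Bool, fderiv ℝ g₁ (coords V) (Pi.single i 1) * fderiv ℝ g₁ (coords V) (Pi.single j 1) * A V i j) ∂(wilsonMeasure (d := 3) (L := L) (fundamentalRep (Fin 2)) β') =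
      ∫ V, (∑ i : Edge 3 L × Fin 2 × Fin 2 × Bool, ∑ j : Edge 3 L × Fin 2 × Fin 2 × Bool, fderiv ℝ f (coords V) (Pi.single i 1) * fderiv ℝ f (coords V) (Pi.single j 1) * A V i j) ∂(wilsonMeasure (d := 3) (L := L) (fundamentalRep (Fin 2)) β') :=
    integral_congr_ae (ae_of_all _ fun V => by beta_reduce; simp only [hg₁fd V])
  have e2 : -∫ V, f (coords V) * gen f V ∂(wilsonMeasure (d := 3) (L := L) (fundamentalRep (Fin 2)) β') =
      1 / 2 * ∫ V, (∑ i : Edge 3 L × Fin 2 × Fin 2 × Bool, ∑ j : Edge 3 L × Fin 2 × Fin 2 × Bool, fderiv ℝ f (coords V) (Pi.single i 1) * fderiv ℝ f (coords V) (Pi.single j 1) * A V i j) ∂(wilsonMeasure (d := 3) (L := L) (fundamentalRep (Fin 2)) β') := by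
    rw [e1]; linarith [hEn, e3]
  rw [e2] at hP
  rw [one_div_mul_eq_div, le_div_iff₀ hc]
  linarith

/-! ## §2. The chain rule `Γ^A(e^{g/2}) = e^g·Γ^A(g)/4` -/

/-- ★★ **Carré du champ of an exponential**: for differentiable `g`, `Γ^A(y ↦ e^{g(y)/2})(V) = (e^{g(coords V)}/4)·Γ^A(g)(V)`. [folklore] -/
theorem carre_exp_half (β' : ℝ) {g : (Edge 3 L × Fin 2 × Fin 2 × Bool → ℝ) → ℝ} (hg : Differentiable ℝ g) (V : GaugeConfig 3 L (Matrix.specialUnitaryGroup (Fin 2) ℂ)) :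
    let coords : GaugeConfig 3 L (Matrix.specialUnitaryGroup (Fin 2) ℂ) → (Edge 3 L × Fin 2 × Fin 2 × Bool → ℝ) :=
      fun V q => (fun z : ℂ => if q.2.2.2 then z.im else z.re)
        ((fundamentalRep (Fin 2) (V q.1) : Matrix (Fin 2) (Fin 2) ℂ) q.2.1 q.2.2.1)
    let A : GaugeConfig 3 L (Matrix.specialUnitaryGroup (Fin 2) ℂ) → (Edge 3 L × Fin 2 × Fin 2 × Bool) →
        (Edge 3 L × Fin 2 × Fin 2 × Bool) → ℝ := fun V i j =>
      ∑ n : Edge 3 L × NoiseIdx 2,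
        (if n.1 = i.1 then (fun z : ℂ => if i.2.2.2 then z.im else z.re)
          ((latticeLangevinDynamics (fundamentalLatticeRep 2) β').noise
            (matrixConfig (fundamentalRep (Fin 2)) V) i.1 n.2 i.2.1 i.2.2.1) else 0) *
        (if n.1 = j.1 then (fun z : ℂ => if j.2.2.2 then z.im else z.re)
          ((latticeLangevinDynamics (fundamentalLatticeRep 2) β').noise
            (matrixConfig (fundamentalRep (Fin 2)) V) j.1 n.2 j.2.1 j.2.2.1) else 0)
    (∑ i : Edge 3 L × Fin 2 × Fin 2 × Bool, ∑ j : Edge 3 L × Fin 2 × Fin 2 × Bool,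
        fderiv ℝ (fun y => Real.exp (g y / 2)) (coords V) (Pi.single i 1) * fderiv ℝ (fun y => Real.exp (g y / 2)) (coords V) (Pi.single j 1) * A V i j) =
      Real.exp (g (coords V)) / 4 * (∑ i : Edge 3 L × Fin 2 × Fin 2 × Bool, ∑ j : Edge 3 L × Fin 2 × Fin 2 × Bool,
        fderiv ℝ g (coords V) (Pi.single i 1) * fderiv ℝ g (coords V) (Pi.single j 1) * A V i j) := by
  intro coords A
  have hfd : ∀ v : (Edge 3 L × Fin 2 × Fin 2 × Bool → ℝ), fderiv ℝ (fun y => Real.exp (g y / 2)) (coords V) v =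
      Real.exp (g (coords V) / 2) * (fderiv ℝ g (coords V) v / 2) := by
    intro v
    have h1 : HasFDerivAt (fun y => g y / 2) ((1 / 2 : ℝ) • fderiv ℝ g (coords V)) (coords V) := by
      have := (hg (coords V)).hasFDerivAt.const_mul (1 / 2 : ℝ)
      refine this.congr_of_eventuallyEq (Eventually.of_forall fun y => ?_)
      show g y / 2 = 1 / 2 * g y
      ring
    have h2 := h1.exp
    rw [h2.fderiv, _root_.smul_apply, _root_.smul_apply, smul_eq_mul, smul_eq_mul]
    ring
  simp_rw [hfd]
  have hsq : Real.exp (g (coords V) / 2) * Real.exp (g (coords V) / 2) = Real.exp (g (coords V)) := by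
    rw [← Real.exp_add]; ring_nf
  rw [Finset.mul_sum]
  refine Finset.sum_congr rfl fun i _ => ?_
  rw [Finset.mul_sum]
  refine Finset.sum_congr rfl fun j _ => ?_
  have : Real.exp (g (coords V) / 2) * (fderiv ℝ g (coords V) (Pi.single i 1) / 2) * (Real.exp (g (coords V) / 2) * (fderiv ℝ g (coords V) (Pi.single j 1) / 2)) =
      (Real.exp (g (coords V) / 2) * Real.exp (g (coords V) / 2)) / 4 * (fderiv ℝ g (coords V) (Pi.single i 1) * fderiv ℝ g (coords V) (Pi.single j 1)) := by ring
  rw [this, hsq]; ring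

end Summit.QuantumFields.YangMills.Theorems.ColdStartUniversality

end
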